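import Mathlib
import Literature.NumberTheory.LFunctions.Zhang2022.Section17U007NuStar
import Literature.NumberTheory.LFunctions.Zhang2022.Section17U007Bounds
import Literature.NumberTheory.LFunctions.Zhang2022.Section17Eq173Holds
import Literature.NumberTheory.LFunctions.Zhang2022.Section17Eval1710
import Literature.NumberTheory.LFunctions.Zhang2022.Section17Eq172
import HarnessLib

/-!
# Zhang (2022) §17.u007 HOLDS, hence (17.5), (17.6): the leaf `Typed.Section17.Eq17_6Rel` discharged

Topic `Literature/NumberTheory/LFunctions/Zhang2022` (Landau–Siegel audit tree; verdict-neutral).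
Y. Zhang, *Discrete mean estimates and the Landau–Siegel zero*, arXiv:2211.02515v1 (2022)
[Zhang2022LandauSiegel] — **an unrefereed manuscript under adjudication**; nothing here asserts or
denies its Theorems 1–2. DAG nodes `Z22:§17.u007` and `Z22:(17.6)` [Z22 p.96, tex L4735–L4763]:

> "A detailed analysis shows that (17.2) [sc. (17.3)] remains valid if, in the expression for `ν*(n)`,
> the factor `κ₂(n₁)` is replaced by `(1∗μ)(n₁)`, the factor `χ(n₂n₃)(ϰ₁(n₂)+ι₂ϰ₂(n₂))(ῑ₃ϰ₃(n₃)+ῑ₄ϰ₄(n₃))`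
> is replaced by `𝔢₀χ(n₂n₃)` with (17.4), and the factors `g̃₂(n₅)` and `g̃₃(n₆)` are replaced by `1`
> respectively. Since `1∗μ∗χ∗χ∗υ∗1∗1 = ν`, it follows by Lemma 17.1 that `Φ₃⁺(p) = 𝔢₀𝔞p + o(p)`. (17.5)
> … `Σ_{ψ∈Ψ₁}(p_ψt₀)^{β₃}I₄⁺(ψ) = −𝔢₀𝔞𝔓 + o(𝔓)`. (17.6)"

The "detailed analysis" is not in print. PROVED here (theorems only; no definitions, no named facts),
completing the kernel chain `Section17U007Engine` → `Section17U007NuStar` → `Section17U007Bounds`: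

* `norm_sum_nuStar_sub_nuRepl_le` — for `𝓛 ≥ 3`, `12(1+5|c′|π)α𝓛 ≤ 1`, `eD⁴ ≤ T²`, `D⁴ ≤ P₂, P₃`:
  `|Σ_{1≤n<D⁴}(ν*(n) − ν_repl(n))ν(n)/n| ≤ K(c′)/𝓛` with an explicit `K(c′)` (the engine's
  `τ`-polynomial majorant with `η = (24π(1+5|c′|π) + 20π + 20170)𝓛⁻⁸`, summed with
  `Σ_{n<D⁴}τ_j|ν|/n ≤ (1+4𝓛)^{2j}`, plus `|𝔢₀ᴰ − 𝔢₀|·Σ|ν|²/n ≤ 100(1+|ι₂|)(|ι₃|+|ι₄|)α𝓛²(1+4𝓛)⁴`);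
  the orders `η, η², …, η⁵` against `𝓛⁴, 𝓛⁸, …, 𝓛¹⁶` are kept separate — each is `O(𝓛⁻⁴)`;
* `step17_u007_holds : ∀ c′, Typed.Section17.Step17_u007 c′` — with the tree's (17.3)
  (`Phi3Eval.eq17_3_holds`), the node §17.u007 BY NAME, for every `c′`, WITHOUT (A) beyond its
  occurrence in the statement (no appeal to `L′(1,χ) = o(𝓛²)`: the cancellations `1∗μ = δ`,
  `χ∗χμ = δ` keep the first-order terms two-factor convolutions);
* `eq17_5_holds`, `eq17_6_holds`, **`eq17_6Rel_holds : ∀ c′, Typed.Section17.Eq17_6Rel c′`** — the leaf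
  `h17_6` of `Skeleton.theorem1_of_leaves_v19` (relative (17.6), reading of record D-G-L4fam-1),
  via the tree's `Phi3Eval.eq17_5_of`, `eq17_6_of` and `Typed.Section17.eq17_6Rel_of_step17_u007`
  (`Section17Eq172`: (17.2) is `Typed.Section17.eq17_2_holds`).

ZHANG-L discharge lane (WP16, seat zl-w16-p6). WHAT THIS IS NOT: a claim about (17.7)–(17.10), about
Theorems 1–2 of the source, or about Landau–Siegel zeros.

## References

* Y. Zhang, arXiv:2211.02515v1 (2022), §17 u007–u009, (17.3)–(17.6) p.96 (tex L4728–L4763), (17.4),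
  Lemma 17.1; §8 (8.6); §2 (2.10)–(2.13), (2.21)–(2.22). [cite: Zhang2022LandauSiegel, §17 (17.5)–(17.6) p.96]
-/

noncomputable section

open Finset Complex
open scoped ComplexConjugate Real
open Literature.NumberTheory.LFunctions.Zhang2022.MeanSquareMajorant
open Literature.NumberTheory.LFunctions.Zhang2022.Skeleton
open Literature.NumberTheory.LFunctions.Zhang2022.Typed.Section17

namespace Literature.NumberTheory.LFunctions.Zhang2022.U007

variable (c' : ℝ)

/-! ## Bookkeeping: monomials `η^a(1+4𝓛)^{2j}` are `O(1/𝓛)` -/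

/-- `(K𝓛⁻⁸)^a (1+4𝓛)^{2j} ≤ K^a 5^{2j} 𝓛⁻¹` for `𝓛 ≥ 1`, `2j+1 ≤ 8a`. [cite: Zhang2022LandauSiegel, §17 u007 p.96] -/
theorem eta_pow_mul_le {L K : ℝ} (hL : 1 ≤ L) (hK : 0 ≤ K) {a j : ℕ} (h : 2 * j + 1 ≤ 8 * a) :
    (K * (L ^ 8)⁻¹) ^ a * (1 + 4 * L) ^ (2 * j) ≤ K ^ a * 5 ^ (2 * j) * L⁻¹ := by
  have hL0 : 0 < L := by linarith
  have h5 : (1 + 4 * L) ^ (2 * j) ≤ (5 * L) ^ (2 * j) :=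
    pow_le_pow_left₀ (by linarith) (by linarith) _
  have hpow : L ^ (2 * j) * L ≤ L ^ (8 * a) := by
    rw [← pow_succ]; exact pow_le_pow_right₀ hL h
  calc (K * (L ^ 8)⁻¹) ^ a * (1 + 4 * L) ^ (2 * j) ≤ (K * (L ^ 8)⁻¹) ^ a * (5 * L) ^ (2 * j) := by
        gcongr
    _ = K ^ a * 5 ^ (2 * j) * (L ^ (2 * j) * (L ^ (8 * a))⁻¹) := by
        rw [mul_pow, mul_pow, inv_pow, ← pow_mul]; ring
    _ ≤ K ^ a * 5 ^ (2 * j) * L⁻¹ := by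
        apply mul_le_mul_of_nonneg_left _ (by positivity)
        rw [← div_eq_mul_inv, div_le_iff₀ (by positivity), ← div_eq_inv_mul, le_div_iff₀ hL0]
        exact hpow

/-! ## The sum `Σ_{n<D⁴}(ν*(n) − ν_repl(n))ν(n)/n` -/

/-- **Step 1 — the pointwise majorant at `η = K₁𝓛⁻⁸`.** For `𝓛 ≥ 3`, `12(1+5|c′|π)α𝓛 ≤ 1`, `eD⁴ ≤ T²`,
`D⁴ ≤ P₂, P₃`, and `1 ≤ n < D⁴`: `|ν*(n) − 𝔢₀ᴰν(n)| ≤ H(3ητ₂+3η²τ₄+η³τ₆)(n) + 2Hη(τ₂+3ητ₂+3η²τ₄+η³τ₆)(n)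
+ Hη²(τ₄+3ητ₄+3η²τ₆+η³τ₈)(n)` with `K₁ = 24π(1+5|c′|π)+20π+20170`, `H = (1+|ι₂|)(|ι₃|+|ι₄|)`.
[cite: Zhang2022LandauSiegel, §17 u007 p.96] -/
theorem norm_nuStar_sub_frake0D_nu_le {D : ℕ} [NeZero D] (χ : DirichletCharacter ℂ D)
    {K₁ H η : ℝ} (hK₁ : K₁ = 24 * π * (1 + 5 * |c'| * π) + 20 * π + 20170)
    (hH : H = (1 + ‖iota2‖) * (‖iota3‖ + ‖iota4‖)) (hη : η = K₁ * (ell D ^ 8)⁻¹) (hℓ : 3 ≤ ell D)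
    (hsmall : 12 * (1 + 5 * |c'| * π) * (alpha D * ell D) ≤ 1)
    (hT : Real.exp 1 * (D : ℝ) ^ 4 ≤ bigT D ^ 2)
    (hD4 : ((D ^ 4 : ℕ) : ℝ) ≤ Skeleton.P2 D) (hD4' : ((D ^ 4 : ℕ) : ℝ) ≤ Skeleton.P3 D)
    {n : ℕ} (hn0 : n ≠ 0) (hn4 : n < D ^ 4) :
    ‖nuStar c' χ n - frake0D D * nu χ n‖ ≤
      H * (3 * η * tau 2 n + 3 * η ^ 2 * tau 4 n + η ^ 3 * tau 6 n) +
        2 * H * η * (tau 2 n + 3 * η * tau 2 n + 3 * η ^ 2 * tau 4 n + η ^ 3 * tau 6 n) +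
        H * η ^ 2 * (tau 4 n + 3 * η * tau 4 n + 3 * η ^ 2 * tau 6 n + η ^ 3 * tau 8 n) := by
  have hL1 : 1 ≤ ell D := by linarith
  have hL0 : 0 < ell D := by linarith
  have hD : 1 ≤ Real.log D := by rw [← ell]; linarith
  have hD2 : 2 ≤ Real.log D := by rw [← ell]; linarith
  have hA1 : 1 ≤ 1 + 5 * |c'| * π := by
    have : 0 ≤ 5 * |c'| * π := by positivity
    linarith
  have hx : 0 ≤ (ell D ^ 8)⁻¹ := by positivity
  have hK₁0 : 0 ≤ K₁ := by rw [hK₁]; positivity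
  have hη0 : 0 ≤ η := by rw [hη]; exact mul_nonneg hK₁0 hx
  have hH0 : 0 ≤ H := by rw [hH]; positivity
  have hαℓ : alpha D * ell D = π * (ell D ^ 8)⁻¹ := Sec12D.alpha_mul_ell_eq hD
  -- the pointwise sizes, at `η`
  have h4 : 4 * (1 + 5 * |c'| * π) * (alpha D * ell D) ≤ 1 := by
    have : 0 ≤ (1 + 5 * |c'| * π) * (alpha D * ell D) := by rw [hαℓ]; positivity
    linarith
  have hAx : 0 ≤ (1 + 5 * |c'| * π) * (ell D ^ 8)⁻¹ := mul_nonneg (by linarith) hx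
  have hπx : 0 ≤ π * (ell D ^ 8)⁻¹ := mul_nonneg Real.pi_pos.le hx
  obtain ⟨-, hβ2, hβ3⟩ := Sec12D.norm_beta123_le c' (D := D) hD
  have hE₁ : ∀ m : ℕ, m ≠ 0 → m < D ^ 4 → ‖powI (b1 c' D) m - 1‖ ≤ η := fun m hm hm4 => by
    refine (norm_powI_sub_one_le c' hD h4 hm hm4).trans ?_
    rw [hη, hαℓ, hK₁]
    nlinarith only [hAx, hπx, Real.pi_pos, mul_nonneg Real.pi_pos.le hAx]
  have hE₂₃ : ∀ {β : ℂ}, ‖β‖ ≤ 3 * alpha D * (1 + 5 * |c'| * π) →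
      ∀ m : ℕ, m ≠ 0 → m < D ^ 4 → ‖nN D β m - 1‖ ≤ η := fun hβ m hm hm4 => by
    refine (norm_nN_sub_one_le c' hD hsmall hT hβ hm hm4).trans ?_
    rw [hη, hαℓ, hK₁]
    nlinarith only [hAx, hπx, Real.pi_pos, mul_nonneg Real.pi_pos.le hAx]
  have hvk : (20 * π + 10) * (ell D ^ 8)⁻¹ ≤ η := by
    rw [hη, hK₁]
    nlinarith only [hAx, hπx, hx, Real.pi_pos, mul_nonneg Real.pi_pos.le hAx]
  have hA₁ : ∀ m : ℕ, m ≠ 0 → m < D ^ 4 →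
      ‖χ (m : ZMod D) * (vk1 D m + iota2 * vk2 D m) - (vk1 D 1 + iota2 * vk2 D 1) * χ (m : ZMod D)‖ ≤
        (1 + ‖iota2‖) * η := fun m hm hm4 =>
    ((norm_A12_sub_le χ hℓ hD4 hD4' hm hm4).1).trans (mul_le_mul_of_nonneg_left hvk (by positivity))
  have hA₂ : ∀ m : ℕ, m ≠ 0 → m < D ^ 4 →
      ‖χ (m : ZMod D) * (conj iota3 * vk3 D m + conj iota4 * vk4 D m) -
          (conj iota3 * vk3 D 1 + conj iota4 * vk4 D 1) * χ (m : ZMod D)‖ ≤ (‖iota3‖ + ‖iota4‖) * η :=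
    fun m hm hm4 =>
    ((norm_A12_sub_le χ hℓ hD4 hD4' hm hm4).2).trans (mul_le_mul_of_nonneg_left hvk (by positivity))
  have t1 := norm_nuStar_sub_frake0D_nu_le_of_bounds c' χ hη0 hE₁ (hE₂₃ hβ2) (hE₂₃ hβ3) hA₁ hA₂ n hn0 hn4
  rw [← hH] at t1
  -- sizes of the constants
  have hc₁ : ‖vk1 D 1 + iota2 * vk2 D 1‖ ≤ 1 + ‖iota2‖ := by
    calc ‖vk1 D 1 + iota2 * vk2 D 1‖ ≤ ‖vk1 D 1‖ + ‖iota2 * vk2 D 1‖ := norm_add_le _ _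
      _ ≤ 1 + ‖iota2‖ * 1 := by rw [norm_mul]; gcongr; exacts [norm_vk1_le hD2 1, norm_vk2_le hD2 1]
      _ = 1 + ‖iota2‖ := by ring
  have hc₂ : ‖conj iota3 * vk3 D 1 + conj iota4 * vk4 D 1‖ ≤ ‖iota3‖ + ‖iota4‖ := by
    calc ‖conj iota3 * vk3 D 1 + conj iota4 * vk4 D 1‖ ≤ ‖conj iota3 * vk3 D 1‖ + ‖conj iota4 * vk4 D 1‖ :=
          norm_add_le _ _
      _ ≤ ‖iota3‖ * 1 + ‖iota4‖ * 1 := by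
          rw [norm_mul, norm_mul, Complex.norm_conj, Complex.norm_conj, vk4]
          gcongr; exacts [norm_vk3_le hD2 1, norm_vk2_le hD2 1]
      _ = ‖iota3‖ + ‖iota4‖ := by ring
  have hF : ‖frake0D D‖ ≤ H := by
    rw [frake0D, norm_mul, hH]; exact mul_le_mul hc₁ hc₂ (norm_nonneg _) (by positivity)
  have hG : ‖vk1 D 1 + iota2 * vk2 D 1‖ * (‖iota3‖ + ‖iota4‖) +
      ‖conj iota3 * vk3 D 1 + conj iota4 * vk4 D 1‖ * (1 + ‖iota2‖) ≤ 2 * H := by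
    have e1 := mul_le_mul_of_nonneg_right hc₁ (by positivity : 0 ≤ ‖iota3‖ + ‖iota4‖)
    have e2 := mul_le_mul_of_nonneg_right hc₂ (by positivity : 0 ≤ 1 + ‖iota2‖)
    rw [hH]; linarith only [e1, e2]
  have hτ : ∀ j, 0 ≤ tau j n := fun j => tau_nonneg j n
  have hη2 : 0 ≤ η ^ 2 := pow_nonneg hη0 2
  have hη3 : 0 ≤ η ^ 3 := pow_nonneg hη0 3
  have hpos1 : 0 ≤ 3 * η * tau 2 n + 3 * η ^ 2 * tau 4 n + η ^ 3 * tau 6 n :=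
    add_nonneg (add_nonneg (mul_nonneg (mul_nonneg (by norm_num) hη0) (hτ 2))
      (mul_nonneg (mul_nonneg (by norm_num) hη2) (hτ 4))) (mul_nonneg hη3 (hτ 6))
  have hpos2 : 0 ≤ tau 2 n + 3 * η * tau 2 n + 3 * η ^ 2 * tau 4 n + η ^ 3 * tau 6 n :=
    add_nonneg (add_nonneg (add_nonneg (hτ 2) (mul_nonneg (mul_nonneg (by norm_num) hη0) (hτ 2)))
      (mul_nonneg (mul_nonneg (by norm_num) hη2) (hτ 4))) (mul_nonneg hη3 (hτ 6))
  have m1 : ‖frake0D D‖ * (3 * η * tau 2 n + 3 * η ^ 2 * tau 4 n + η ^ 3 * tau 6 n) ≤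
      H * (3 * η * tau 2 n + 3 * η ^ 2 * tau 4 n + η ^ 3 * tau 6 n) :=
    mul_le_mul_of_nonneg_right hF hpos1
  have m2 : (‖vk1 D 1 + iota2 * vk2 D 1‖ * (‖iota3‖ + ‖iota4‖) +
      ‖conj iota3 * vk3 D 1 + conj iota4 * vk4 D 1‖ * (1 + ‖iota2‖)) * η *
      (tau 2 n + 3 * η * tau 2 n + 3 * η ^ 2 * tau 4 n + η ^ 3 * tau 6 n) ≤
      2 * H * η * (tau 2 n + 3 * η * tau 2 n + 3 * η ^ 2 * tau 4 n + η ^ 3 * tau 6 n) := by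
    rw [mul_assoc, mul_assoc (2 * H)]
    exact mul_le_mul_of_nonneg_right hG (mul_nonneg hη0 hpos2)
  exact t1.trans (add_le_add (add_le_add m1 m2) le_rfl)

/-- **Step 2 — termwise, against `ν(n)/n`**: with `ν_repl = 𝔢₀ν` (§17.u008) and `|𝔢₀ᴰ − 𝔢₀| ≤ 100Hα𝓛²`,
`|(ν*(n) − ν_repl(n))ν(n)/n| ≤ (B_η(n) + 100Hα𝓛²·τ₂(n))·|ν(n)|/n` for `1 ≤ n < D⁴`.
[cite: Zhang2022LandauSiegel, §17 u007–u008 p.96] -/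
theorem norm_term_le {D : ℕ} [NeZero D] (χ : DirichletCharacter ℂ D)
    {K₁ H η : ℝ} (hK₁ : K₁ = 24 * π * (1 + 5 * |c'| * π) + 20 * π + 20170)
    (hH : H = (1 + ‖iota2‖) * (‖iota3‖ + ‖iota4‖)) (hη : η = K₁ * (ell D ^ 8)⁻¹) (hℓ : 3 ≤ ell D)
    (hsmall : 12 * (1 + 5 * |c'| * π) * (alpha D * ell D) ≤ 1)
    (hT : Real.exp 1 * (D : ℝ) ^ 4 ≤ bigT D ^ 2)
    (hD4 : ((D ^ 4 : ℕ) : ℝ) ≤ Skeleton.P2 D) (hD4' : ((D ^ 4 : ℕ) : ℝ) ≤ Skeleton.P3 D)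
    {n : ℕ} (hn : n ∈ Ico 1 (D ^ 4)) :
    ‖(nuStar c' χ n - nuRepl χ n) * nu χ n / (n : ℂ)‖ ≤
      (H * (3 * η * tau 2 n + 3 * η ^ 2 * tau 4 n + η ^ 3 * tau 6 n) +
        2 * H * η * (tau 2 n + 3 * η * tau 2 n + 3 * η ^ 2 * tau 4 n + η ^ 3 * tau 6 n) +
        H * η ^ 2 * (tau 4 n + 3 * η * tau 4 n + 3 * η ^ 2 * tau 6 n + η ^ 3 * tau 8 n) +
        100 * H * (alpha D * ell D ^ 2) * tau 2 n) * (‖nu χ n‖ / n) := by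
  have hn1 : 1 ≤ n := (mem_Ico.mp hn).1
  have hn0 : n ≠ 0 := by omega
  have hn4 : n < D ^ 4 := (mem_Ico.mp hn).2
  have hrepl : nuRepl χ n = frake0 * nu χ n := by
    rw [Phi3Eval.nuRepl_eq_frake0_mul, step17_u008_holds χ n hn1]
  have hsplit : (nuStar c' χ n - nuRepl χ n) = (nuStar c' χ n - frake0D D * nu χ n) +
      (frake0D D - frake0) * nu χ n := by rw [hrepl]; ring
  rw [norm_div, norm_mul, hsplit, Complex.norm_natCast, mul_div_assoc]
  refine mul_le_mul_of_nonneg_right ?_ (by positivity)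
  have hν : ‖nu χ n‖ ≤ tau 2 n := Lemma34.norm_nu_le χ n
  have t1 := norm_nuStar_sub_frake0D_nu_le c' χ hK₁ hH hη hℓ hsmall hT hD4 hD4' hn0 hn4
  have hdd : ‖frake0D D - frake0‖ ≤ 100 * H * (alpha D * ell D ^ 2) := by
    have h := norm_frake0D_sub_frake0_le (D := D) hℓ
    rw [hH]; convert h using 1; ring
  have t2 : ‖(frake0D D - frake0) * nu χ n‖ ≤ 100 * H * (alpha D * ell D ^ 2) * tau 2 n := by
    rw [norm_mul]; exact mul_le_mul hdd hν (norm_nonneg _) (le_trans (norm_nonneg _) hdd)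
  exact (norm_add_le _ _).trans (add_le_add t1 t2)

/-- **Step 3 — the bookkeeping inequality** (pure real arithmetic): with `η = K₁L⁻⁸`, `L ≥ 1`, and
`0 ≤ S_j ≤ (1+4L)^{2j}`, the summed majorant is `≤ K(c′)·L⁻¹`. [cite: Zhang2022LandauSiegel, §17 u007 p.96] -/
theorem bookkeeping {L K₁ H η d S₂ S₄ S₆ S₈ : ℝ} (hL : 1 ≤ L) (hK₁ : 0 ≤ K₁) (hH : 0 ≤ H)
    (hη : η = K₁ * (L ^ 8)⁻¹) (hd0 : 0 ≤ d) (hd : d * (1 + 4 * L) ^ (2 * 2) ≤ H * (62500 * π) * L⁻¹)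
    (h2 : S₂ ≤ (1 + 4 * L) ^ (2 * 2)) (h4 : S₄ ≤ (1 + 4 * L) ^ (2 * 4)) (h6 : S₆ ≤ (1 + 4 * L) ^ (2 * 6))
    (h8 : S₈ ≤ (1 + 4 * L) ^ (2 * 8)) :
    (H * (3 * η) + 2 * H * η * (1 + 3 * η) + d) * S₂ +
        (H * (3 * η ^ 2) + 2 * H * η * (3 * η ^ 2) + H * η ^ 2 * (1 + 3 * η)) * S₄ +
        (H * η ^ 3 + 2 * H * η * η ^ 3 + H * η ^ 2 * (3 * η ^ 2)) * S₆ + H * η ^ 2 * η ^ 3 * S₈ ≤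
      H * (5 * K₁ * 5 ^ (2 * 2) + 6 * K₁ ^ 2 * 5 ^ (2 * 2) + 4 * K₁ ^ 2 * 5 ^ (2 * 4) +
        9 * K₁ ^ 3 * 5 ^ (2 * 4) + K₁ ^ 3 * 5 ^ (2 * 6) + 5 * K₁ ^ 4 * 5 ^ (2 * 6) + K₁ ^ 5 * 5 ^ (2 * 8) +
        62500 * π) * L⁻¹ := by
  have hx : 0 ≤ (L ^ 8)⁻¹ := by positivity
  have hη0 : 0 ≤ η := by rw [hη]; exact mul_nonneg hK₁ hx
  have hη2 : 0 ≤ η ^ 2 := pow_nonneg hη0 2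
  have hη3 : 0 ≤ η ^ 3 := pow_nonneg hη0 3
  have h13 : 0 ≤ 1 + 3 * η := by linarith only [hη0]
  have c1 : 0 ≤ H * (3 * η) + 2 * H * η * (1 + 3 * η) + d :=
    add_nonneg (add_nonneg (mul_nonneg hH (mul_nonneg (by norm_num) hη0))
      (mul_nonneg (mul_nonneg (mul_nonneg (by norm_num) hH) hη0) h13)) hd0
  have c2 : 0 ≤ H * (3 * η ^ 2) + 2 * H * η * (3 * η ^ 2) + H * η ^ 2 * (1 + 3 * η) :=
    add_nonneg (add_nonneg (mul_nonneg hH (mul_nonneg (by norm_num) hη2))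
      (mul_nonneg (mul_nonneg (mul_nonneg (by norm_num) hH) hη0) (mul_nonneg (by norm_num) hη2)))
      (mul_nonneg (mul_nonneg hH hη2) h13)
  have c3 : 0 ≤ H * η ^ 3 + 2 * H * η * η ^ 3 + H * η ^ 2 * (3 * η ^ 2) :=
    add_nonneg (add_nonneg (mul_nonneg hH hη3) (mul_nonneg (mul_nonneg (mul_nonneg (by norm_num) hH) hη0) hη3))
      (mul_nonneg (mul_nonneg hH hη2) (mul_nonneg (by norm_num) hη2))
  have c4 : 0 ≤ H * η ^ 2 * η ^ 3 := mul_nonneg (mul_nonneg hH hη2) hη3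
  have step := add_le_add (add_le_add (add_le_add (mul_le_mul_of_nonneg_left h2 c1)
    (mul_le_mul_of_nonneg_left h4 c2)) (mul_le_mul_of_nonneg_left h6 c3))
    (mul_le_mul_of_nonneg_left h8 c4)
  refine step.trans ?_
  have e := fun (a j : ℕ) (h : 2 * j + 1 ≤ 8 * a) => eta_pow_mul_le hL hK₁ (a := a) (j := j) h
  have m11 := e 1 2 (by norm_num)
  have m22 := e 2 2 (by norm_num)
  have m24 := e 2 4 (by norm_num)
  have m34 := e 3 4 (by norm_num)
  have m36 := e 3 6 (by norm_num)
  have m46 := e 4 6 (by norm_num)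
  have m58 := e 5 8 (by norm_num)
  rw [← hη] at m11 m22 m24 m34 m36 m46 m58
  rw [pow_one, pow_one] at m11
  have f11 := mul_le_mul_of_nonneg_left m11 hH
  have f22 := mul_le_mul_of_nonneg_left m22 hH
  have f24 := mul_le_mul_of_nonneg_left m24 hH
  have f34 := mul_le_mul_of_nonneg_left m34 hH
  have f36 := mul_le_mul_of_nonneg_left m36 hH
  have f46 := mul_le_mul_of_nonneg_left m46 hH
  have f58 := mul_le_mul_of_nonneg_left m58 hH
  linarith only [f11, f22, f24, f34, f36, f46, f58, hd]

/-- **The core estimate of §17.u007**: there is `K = K(c′)` with, for `𝓛 ≥ 3`, `12(1+5|c′|π)α𝓛 ≤ 1`,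
`eD⁴ ≤ T²`, `D⁴ ≤ P₂, P₃` (every modulus `D`, every character `χ`):
`|Σ_{1≤n<D⁴}(ν*(n) − ν_repl(n))ν(n)/n| ≤ K/𝓛`. [cite: Zhang2022LandauSiegel, §17 u007 p.96] -/
theorem norm_sum_nuStar_sub_nuRepl_le :
    ∃ K : ℝ, 0 ≤ K ∧ ∀ (D : ℕ) [NeZero D] (χ : DirichletCharacter ℂ D), 3 ≤ ell D →
      12 * (1 + 5 * |c'| * π) * (alpha D * ell D) ≤ 1 → Real.exp 1 * (D : ℝ) ^ 4 ≤ bigT D ^ 2 →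
      ((D ^ 4 : ℕ) : ℝ) ≤ Skeleton.P2 D → ((D ^ 4 : ℕ) : ℝ) ≤ Skeleton.P3 D →
        ‖∑ n ∈ Ico 1 (D ^ 4), (nuStar c' χ n - nuRepl χ n) * nu χ n / (n : ℂ)‖ ≤ K * (ell D)⁻¹ := by
  set A : ℝ := 1 + 5 * |c'| * π with hA
  set K₁ : ℝ := 24 * π * A + 20 * π + 20170 with hK₁
  set H : ℝ := (1 + ‖iota2‖) * (‖iota3‖ + ‖iota4‖) with hH
  have hA1 : 1 ≤ A := by
    have : 0 ≤ 5 * |c'| * π := by positivity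
    rw [hA]; linarith
  have hK₁0 : 0 ≤ K₁ := by rw [hK₁]; positivity
  have hH0 : 0 ≤ H := by rw [hH]; positivity
  refine ⟨H * (5 * K₁ * 5 ^ (2 * 2) + 6 * K₁ ^ 2 * 5 ^ (2 * 2) + 4 * K₁ ^ 2 * 5 ^ (2 * 4) +
      9 * K₁ ^ 3 * 5 ^ (2 * 4) + K₁ ^ 3 * 5 ^ (2 * 6) + 5 * K₁ ^ 4 * 5 ^ (2 * 6) + K₁ ^ 5 * 5 ^ (2 * 8) +
      62500 * π), by positivity, ?_⟩
  intro D _ χ hℓ hsmall hT hD4 hD4'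
  set L : ℝ := ell D with hLdef
  set η : ℝ := K₁ * (L ^ 8)⁻¹ with hη
  have hL1 : 1 ≤ L := by rw [hLdef]; linarith
  have hL0 : 0 < L := by linarith
  have hD : 1 ≤ Real.log D := by rw [← ell]; linarith
  have hαℓ : alpha D * ell D = π * (L ^ 8)⁻¹ := by rw [hLdef]; exact Sec12D.alpha_mul_ell_eq hD
  -- termwise
  have hterm : ∀ n ∈ Ico 1 (D ^ 4), ‖(nuStar c' χ n - nuRepl χ n) * nu χ n / (n : ℂ)‖ ≤
      (H * (3 * η * tau 2 n + 3 * η ^ 2 * tau 4 n + η ^ 3 * tau 6 n) +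
        2 * H * η * (tau 2 n + 3 * η * tau 2 n + 3 * η ^ 2 * tau 4 n + η ^ 3 * tau 6 n) +
        H * η ^ 2 * (tau 4 n + 3 * η * tau 4 n + 3 * η ^ 2 * tau 6 n + η ^ 3 * tau 8 n) +
        100 * H * (alpha D * ell D ^ 2) * tau 2 n) * (‖nu χ n‖ / n) := fun n hn =>
    norm_term_le c' χ hK₁ hH hη hℓ hsmall hT hD4 hD4' hn
  -- summation
  have hS : ∀ j : ℕ, ∑ n ∈ Ico 1 (D ^ 4), tau j n * ‖nu χ n‖ / n ≤ (1 + 4 * L) ^ (2 * j) := by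
    intro j
    have h := sum_tau_mul_norm_le (ν := nu χ) (fun n _ => Lemma34.norm_nu_le χ n) j (D ^ 4)
    have hlog : Real.log ((D ^ 4 : ℕ) : ℝ) = 4 * L := by
      rw [Nat.cast_pow, Real.log_pow, hLdef, ell]; norm_num
    rwa [hlog] at h
  refine ((norm_sum_le _ _).trans (sum_le_sum hterm)).trans ?_
  set d : ℝ := 100 * H * (alpha D * ell D ^ 2) with hd
  have hlin : ∑ n ∈ Ico 1 (D ^ 4),
      (H * (3 * η * tau 2 n + 3 * η ^ 2 * tau 4 n + η ^ 3 * tau 6 n) +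
        2 * H * η * (tau 2 n + 3 * η * tau 2 n + 3 * η ^ 2 * tau 4 n + η ^ 3 * tau 6 n) +
        H * η ^ 2 * (tau 4 n + 3 * η * tau 4 n + 3 * η ^ 2 * tau 6 n + η ^ 3 * tau 8 n) +
        d * tau 2 n) * (‖nu χ n‖ / n) =
      (H * (3 * η) + 2 * H * η * (1 + 3 * η) + d) * ∑ n ∈ Ico 1 (D ^ 4), tau 2 n * ‖nu χ n‖ / n +
      (H * (3 * η ^ 2) + 2 * H * η * (3 * η ^ 2) + H * η ^ 2 * (1 + 3 * η)) *
        ∑ n ∈ Ico 1 (D ^ 4), tau 4 n * ‖nu χ n‖ / n +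
      (H * η ^ 3 + 2 * H * η * η ^ 3 + H * η ^ 2 * (3 * η ^ 2)) * ∑ n ∈ Ico 1 (D ^ 4), tau 6 n * ‖nu χ n‖ / n +
      (H * η ^ 2 * η ^ 3) * ∑ n ∈ Ico 1 (D ^ 4), tau 8 n * ‖nu χ n‖ / n := by
    rw [mul_sum, mul_sum, mul_sum, mul_sum, ← sum_add_distrib, ← sum_add_distrib, ← sum_add_distrib]
    exact sum_congr rfl fun n _ => by ring
  rw [hlin]
  -- the `𝔢₀ᴰ − 𝔢₀` term: `100Hα𝓛²(1+4𝓛)⁴ ≤ 62500πH/𝓛`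
  have hα2 : alpha D * ell D ^ 2 = π * (L ^ 8)⁻¹ * L := by
    rw [show alpha D * ell D ^ 2 = (alpha D * ell D) * ell D by ring, hαℓ, hLdef]
  have hd0 : 0 ≤ d := by rw [hd, hα2]; positivity
  have hdd : d * (1 + 4 * L) ^ (2 * 2) ≤ H * (62500 * π) * L⁻¹ := by
    rw [hd, hα2]
    have h5 : (1 + 4 * L) ^ (2 * 2) ≤ (5 * L) ^ (2 * 2) := pow_le_pow_left₀ (by linarith) (by linarith) _
    have hpow : L ^ 4 * L * L ≤ L ^ 8 := by
      rw [show L ^ 4 * L * L = L ^ 6 by ring]; exact pow_le_pow_right₀ hL1 (by norm_num)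
    calc 100 * H * (π * (L ^ 8)⁻¹ * L) * (1 + 4 * L) ^ (2 * 2)
        ≤ 100 * H * (π * (L ^ 8)⁻¹ * L) * (5 * L) ^ (2 * 2) := by gcongr
      _ = H * (62500 * π) * (L ^ 4 * L * (L ^ 8)⁻¹) := by ring
      _ ≤ H * (62500 * π) * L⁻¹ := by
          apply mul_le_mul_of_nonneg_left _ (by positivity)
          rw [← div_eq_mul_inv, div_le_iff₀ (by positivity), ← div_eq_inv_mul, le_div_iff₀ hL0]
          exact hpow
  exact bookkeeping hL1 hK₁0 hH0 hη hd0 hdd (hS 2) (hS 4) (hS 6) (hS 8)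

/-! ## Largeness -/

/-- For `𝓛 ≥ 9537` (`≥ (5/2)^{10}`) and `𝓛 ≥ 12(1+5|c′|π)π`: `𝓛 ≥ 3`, `12(1+5|c′|π)α𝓛 ≤ 1`, `eD⁴ ≤ T²`
(`T² = e^{2𝓛^{1.1}}`, `𝓛^{0.1} ≥ 5/2`), `D⁴ ≤ P₂`, `D⁴ ≤ P₃`. [cite: Zhang2022LandauSiegel, §2 (2.10), (2.21)–(2.22)] -/
theorem largeness {D : ℕ} [NeZero D] (hℓ : 9537 ≤ ell D) (hc : 12 * (1 + 5 * |c'| * π) * π ≤ ell D) :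
    3 ≤ ell D ∧ 12 * (1 + 5 * |c'| * π) * (alpha D * ell D) ≤ 1 ∧ Real.exp 1 * (D : ℝ) ^ 4 ≤ bigT D ^ 2 ∧
      ((D ^ 4 : ℕ) : ℝ) ≤ Skeleton.P2 D ∧ ((D ^ 4 : ℕ) : ℝ) ≤ Skeleton.P3 D := by
  have h3 : 3 ≤ ell D := by linarith
  have hℓ1 : 1 ≤ ell D := by linarith
  have hℓ0 : 0 < ell D := by linarith
  have hD : 1 ≤ Real.log D := by rw [← ell]; exact hℓ1
  have hDpos : (0 : ℝ) < D := by exact_mod_cast Nat.pos_of_ne_zero (NeZero.ne D)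
  have hDexp : (D : ℝ) = Real.exp (ell D) := by rw [ell, Real.exp_log hDpos]
  have hD4 : (D : ℝ) ^ 4 = Real.exp (4 * ell D) := by rw [hDexp, ← Real.exp_nat_mul]; norm_num
  have hD4' : ((D ^ 4 : ℕ) : ℝ) = Real.exp (4 * ell D) := by rw [Nat.cast_pow, hD4]
  -- (b) `12Aα𝓛 ≤ 1`
  have hb : 12 * (1 + 5 * |c'| * π) * (alpha D * ell D) ≤ 1 := by
    rw [Sec12D.alpha_mul_ell_eq hD]
    have h8 : ell D ≤ ell D ^ 8 := le_self_pow₀ hℓ1 (by norm_num)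
    have hinv : (ell D ^ 8)⁻¹ ≤ (ell D)⁻¹ := inv_anti₀ hℓ0 h8
    have hA : 0 ≤ 12 * (1 + 5 * |c'| * π) * π := by positivity
    calc 12 * (1 + 5 * |c'| * π) * (π * (ell D ^ 8)⁻¹) = (12 * (1 + 5 * |c'| * π) * π) * (ell D ^ 8)⁻¹ := by
          ring
      _ ≤ (12 * (1 + 5 * |c'| * π) * π) * (ell D)⁻¹ := mul_le_mul_of_nonneg_left hinv hA
      _ ≤ ell D * (ell D)⁻¹ := mul_le_mul_of_nonneg_right hc (by positivity)
      _ = 1 := mul_inv_cancel₀ hℓ0.ne'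
  -- (c) `eD⁴ ≤ T²`
  have hc' : Real.exp 1 * (D : ℝ) ^ 4 ≤ bigT D ^ 2 := by
    rw [hD4, ← Real.exp_add, bigT, ← Real.exp_nat_mul, Real.exp_le_exp]
    have h01 : (5 / 2 : ℝ) ≤ ell D ^ (0.1 : ℝ) := by
      have e1 : ((5 / 2 : ℝ) ^ 10) ^ (0.1 : ℝ) = 5 / 2 := by
        rw [show (0.1 : ℝ) = ((10 : ℕ) : ℝ)⁻¹ by norm_num]
        exact Real.pow_rpow_inv_natCast (by norm_num) (by norm_num)
      rw [← e1]
      exact Real.rpow_le_rpow (by norm_num) (le_trans (by norm_num) hℓ) (by norm_num)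
    have h11 : ell D ^ (1.1 : ℝ) = ell D * ell D ^ (0.1 : ℝ) := by
      rw [show (1.1 : ℝ) = 1 + 0.1 by norm_num, Real.rpow_add hℓ0, Real.rpow_one]
    rw [h11]
    push_cast
    nlinarith
  -- (d), (e) `D⁴ ≤ P₂, P₃`
  obtain ⟨-, hl2, hl3, -, hP2, hP3⟩ := log_P123_ge (D := D) h3
  have h49 : 4 * ell D ≤ 0.4 * ell D ^ 9 := by
    have h8 : 6561 ≤ ell D ^ 8 := le_trans (by norm_num) (pow_le_pow_left₀ (by norm_num) h3 8)
    nlinarith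
  have hdP : ∀ {P : ℝ}, 1 < P → 0.4 * ell D ^ 9 ≤ Real.log P → ((D ^ 4 : ℕ) : ℝ) ≤ P := by
    intro P hP hlP
    rw [hD4', ← Real.exp_log (by linarith : 0 < P), Real.exp_le_exp]
    linarith
  exact ⟨h3, hb, hc', hdP hP2 hl2, hdP hP3 hl3⟩

/-- **`Σ_{1≤n<D⁴}(ν*(n) − ν_repl(n))ν(n)/n = o(1)`**, for every `c′`, along all large `D` and all
characters (no (A) needed). [cite: Zhang2022LandauSiegel, §17 u007 p.96] -/
theorem forAllLarge_norm_sum_nuStar_sub_nuRepl_le (ε : ℝ) (hε : 0 < ε) :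
    ForAllLarge fun D _ χ =>
      ‖∑ n ∈ Ico 1 (D ^ 4), (nuStar c' χ n - nuRepl χ n) * nu χ n / (n : ℂ)‖ ≤ ε := by
  obtain ⟨K, hK0, hK⟩ := norm_sum_nuStar_sub_nuRepl_le c'
  refine (Phi3Eval.forAllLarge_le_ell (max (max 9537 (12 * (1 + 5 * |c'| * π) * π)) (K / ε))).mono ?_
  intro D _ χ _ _ hL
  have h1 : 9537 ≤ ell D := le_trans (le_trans (le_max_left _ _) (le_max_left _ _)) hL
  have h2 : 12 * (1 + 5 * |c'| * π) * π ≤ ell D := le_trans (le_trans (le_max_right _ _) (le_max_left _ _)) hL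
  have h3 : K / ε ≤ ell D := le_trans (le_max_right _ _) hL
  have hℓ0 : 0 < ell D := by linarith
  obtain ⟨hℓ3, hsmall, hT, hP2, hP3⟩ := largeness c' h1 h2
  refine (hK D χ hℓ3 hsmall hT hP2 hP3).trans ?_
  rw [div_le_iff₀ hε] at h3
  rw [← div_eq_mul_inv, div_le_iff₀ hℓ0]
  linarith

/-! ## §17.u007, (17.5), (17.6) -/

/-- **`Z22:§17.u007` HOLDS** (every `c′`): for every `ε > 0`, all large `D`, every real primitive `χ`
with (A), every `p ∼ P`: `‖Φ₃⁺(p) − p·Σ_{1≤n<D⁴}ν_repl(n)ν(n)/n‖ ≤ εp` — from (17.3)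
(`Phi3Eval.eq17_3_holds`) and `forAllLarge_norm_sum_nuStar_sub_nuRepl_le`.
[cite: Zhang2022LandauSiegel, §17 u007 p.96, tex L4735–L4747] -/
theorem step17_u007_holds (c' : ℝ) : Step17_u007 c' := by
  intro ε hε
  have hε2 : 0 < ε / 2 := by positivity
  refine ((Phi3Eval.eq17_3_holds c' (ε / 2) hε2).and
    (forAllLarge_norm_sum_nuStar_sub_nuRepl_le c' (ε / 2) hε2)).mono ?_
  intro D _ χ _ _ h hA p hp
  obtain ⟨h173, hsum⟩ := h
  have h1 := h173 hA p hp
  have hp0 : (0 : ℝ) ≤ p := Nat.cast_nonneg p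
  have hdiff : ∑ n ∈ Ico 1 (D ^ 4), (nuStar c' χ n - nuRepl χ n) * nu χ n / (n : ℂ) =
      ∑ n ∈ Ico 1 (D ^ 4), nuStar c' χ n * nu χ n / (n : ℂ) -
        ∑ n ∈ Ico 1 (D ^ 4), nuRepl χ n * nu χ n / (n : ℂ) := by
    rw [← sum_sub_distrib]; exact sum_congr rfl fun n _ => by ring
  have hsplit : Phi3plus c' χ p - (p : ℂ) * ∑ n ∈ Ico 1 (D ^ 4), nuRepl χ n * nu χ n / (n : ℂ) =
      (Phi3plus c' χ p - (p : ℂ) * ∑ n ∈ Ico 1 (D ^ 4), nuStar c' χ n * nu χ n / (n : ℂ)) +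
        (p : ℂ) * ∑ n ∈ Ico 1 (D ^ 4), (nuStar c' χ n - nuRepl χ n) * nu χ n / (n : ℂ) := by
    rw [hdiff]; ring
  rw [hsplit]
  calc ‖(Phi3plus c' χ p - (p : ℂ) * ∑ n ∈ Ico 1 (D ^ 4), nuStar c' χ n * nu χ n / (n : ℂ)) +
        (p : ℂ) * ∑ n ∈ Ico 1 (D ^ 4), (nuStar c' χ n - nuRepl χ n) * nu χ n / (n : ℂ)‖
      ≤ ε / 2 * p + ‖(p : ℂ)‖ * ‖∑ n ∈ Ico 1 (D ^ 4), (nuStar c' χ n - nuRepl χ n) * nu χ n / (n : ℂ)‖ := by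
        refine (norm_add_le _ _).trans (add_le_add h1 ?_)
        rw [norm_mul]
    _ ≤ ε / 2 * p + p * (ε / 2) := by
        rw [Complex.norm_natCast]; exact add_le_add le_rfl (mul_le_mul_of_nonneg_left hsum hp0)
    _ = ε * p := by ring

variable (c' : ℝ) in
/-- `Step17_u007` — `_holds` alias of `step17_u007_holds` above under the fact's exact name, stated under the
prover's own binders as section variables (appended 2026-08-28, D-0026 bookkeeping: the proof term is the
existing theorem of this file; no statement, definition or attribute is edited; no new named fact; the
ledger's debt table listed the fact unproved). [cite: Zhang2022LandauSiegel, §17 u007 p.96, tex L4735–L4747] -/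
theorem _root_.Literature.NumberTheory.LFunctions.Zhang2022.Typed.Section17.Step17_u007_holds :
    _root_.Literature.NumberTheory.LFunctions.Zhang2022.Typed.Section17.Step17_u007 c' :=
  _root_.Literature.NumberTheory.LFunctions.Zhang2022.U007.step17_u007_holds (c' := c')

/-- **(17.5) HOLDS** (every `c′`): "`Φ₃⁺(p) = 𝔢₀𝔞p + o(p)`" — §17.u007 + §17.u008 + Lemma 17.1, via
the tree's `Phi3Eval.eq17_5_of`. [cite: Zhang2022LandauSiegel, §17 (17.5) p.96] -/
theorem eq17_5_holds (c' : ℝ) : Eq17_5 c' :=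
  Phi3Eval.eq17_5_of (step17_u007_holds c') fun _ _ χ => step17_u008_holds χ

variable (c' : ℝ) in
/-- `Eq17_5` — `_holds` alias of `eq17_5_holds` above under the fact's exact name, stated under the
prover's own binders as section variables (appended 2026-08-28, D-0026 bookkeeping: the proof term is the
existing theorem of this file; no statement, definition or attribute is edited; no new named fact; the
ledger's debt table listed the fact unproved). [cite: Zhang2022LandauSiegel, §17 (17.5) p.96] -/
theorem _root_.Literature.NumberTheory.LFunctions.Zhang2022.Typed.Section17.Eq17_5_holds :
    _root_.Literature.NumberTheory.LFunctions.Zhang2022.Typed.Section17.Eq17_5 c' :=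
  _root_.Literature.NumberTheory.LFunctions.Zhang2022.U007.eq17_5_holds (c' := c')

/-- **(17.6) HOLDS as printed** (every `c′`): "`Σ_{ψ∈Ψ₁}(p_ψt₀)^{β₃}I₄⁺(ψ) = −𝔢₀𝔞𝔓 + o(𝔓)`" — (17.2)
(`Typed.Section17.eq17_2_holds`) + (17.5), via `Phi3Eval.eq17_6_of`. [cite: Zhang2022LandauSiegel, §17 (17.6) p.96] -/
theorem eq17_6_holds (c' : ℝ) : Eq17_6 c' :=
  Phi3Eval.eq17_6_of (Typed.Section17.eq17_2_holds c') (eq17_5_holds c')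

variable (c' : ℝ) in
/-- `Eq17_6` — `_holds` alias of `eq17_6_holds` above under the fact's exact name, stated under the
prover's own binders as section variables (appended 2026-08-28, D-0026 bookkeeping: the proof term is the
existing theorem of this file; no statement, definition or attribute is edited; no new named fact; the
ledger's debt table listed the fact unproved). [cite: Zhang2022LandauSiegel, §17 (17.6) p.96] -/
theorem _root_.Literature.NumberTheory.LFunctions.Zhang2022.Typed.Section17.Eq17_6_holds :
    _root_.Literature.NumberTheory.LFunctions.Zhang2022.Typed.Section17.Eq17_6 c' :=
  _root_.Literature.NumberTheory.LFunctions.Zhang2022.U007.eq17_6_holds (c' := c')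

end Literature.NumberTheory.LFunctions.Zhang2022.U007

namespace Literature.NumberTheory.LFunctions.Zhang2022.Typed.Section17

/-- **`Z22:§17.u007` DISCHARGED, by name** (every `c′`). [cite: Zhang2022LandauSiegel, §17 u007 p.96] -/
theorem step17_u007_holds (c' : ℝ) : Step17_u007 c' := U007.step17_u007_holds c'

/-- **The leaf `h17_6` of `Skeleton.theorem1_of_leaves_v19` DISCHARGED, by name** (every `c′`): the
relative (17.6) `Typed.Section17.Eq17_6Rel c′` (reading of record D-G-L4fam-1) — via
`eq17_6Rel_of_step17_u007` (`Section17Eq172`) at `step17_u007_holds`. [cite: Zhang2022LandauSiegel, §17 (17.6) p.96] -/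
theorem eq17_6Rel_holds (c' : ℝ) : Eq17_6Rel c' := eq17_6Rel_of_step17_u007 (U007.step17_u007_holds c')

variable (c' : ℝ) in
/-- `Eq17_6Rel` — `_holds` alias of `eq17_6Rel_holds` above under the fact's exact name, stated under the
prover's own binders as section variables (appended 2026-08-28, D-0026 bookkeeping: the proof term is the
existing theorem of this file; no statement, definition or attribute is edited; no new named fact; the
ledger's debt table listed the fact unproved). [cite: Zhang2022LandauSiegel, §17 (17.6) p.96] -/
theorem _root_.Literature.NumberTheory.LFunctions.Zhang2022.Typed.Section17.Eq17_6Rel_holds :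
    _root_.Literature.NumberTheory.LFunctions.Zhang2022.Typed.Section17.Eq17_6Rel c' :=
  _root_.Literature.NumberTheory.LFunctions.Zhang2022.Typed.Section17.eq17_6Rel_holds (c' := c')

end Literature.NumberTheory.LFunctions.Zhang2022.Typed.Section17

end
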